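/-
Copyright (c) 2026 the pub-hodgecm-mathlib formalisation cell (harness21).  Prover seat hodgecm-mathlib-F0P2-p01 (g16): road «S3-ram» (LEAD F0P3a-plan (g13); owner F0P3a-p06),
(T2) G-side organ (Cnt2′) (chair F0P3a-p07 (g14) rulings (3)(6)(8)), organ (z1-c) «TUBE LAYERS b ≥ 1», PART II(b=1) «COLLAR TOKENS» — the CHILD-LINE LAW; 2026-09-02.
-/
import Literature.NumberTheory.Automorphic.UnitaryLatticeTreeTubeCollarGate       -- ★ p848957 (this seat): THE GATE `axisVertex_eq_latt_endoGL_of_scaleLattice_le`; brings ★ p848616 TubeCollarTokens (K0–K3), ★ TubeCone ∕ TubeAxisVertex ∕ TubeCoordinate, ★ AxisEndoFrame `isSelfDualLattice_latt_endoGL_one_iff`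
import Literature.NumberTheory.Automorphic.UnitaryLatticeTreeTubeCollarTopLevel   -- ★ p848891 (this seat): (K4) `collar_levTop_iff_of_axisLevel`
import HarnessLib

/-!
# The lattice graph of a hermitian space — COLLAR TOKENS, THE CHILD-LINE LAW: every self-dual lattice hanging below a NON-AXIAL child `c_x = {m ∈ v : ⟨x, m⟩ ∈ ϖ𝒪}` of a
# self-dual axis vertex `v` is a collar lattice of `v` glued along `x`, and its tokens are read on the ONE residue `ϖ^{−D}⟨x, (Γ − 1)x⟩` (Kottwitz 1986 §3; Rogawski 1990 §4.9)

Topic `NumberTheory/Automorphic`; namespace `Literature.NumberTheory.Automorphic.UnitaryLatticeTree`.  THEOREMS ONLY (no definition, no instance, no notation, no named fact,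
no `sorry`); kernel lane `--supports stmt-HodgeConjecture-24833`; datum-free (`K` with `Valued K ℤᵐ⁰`, `[IsPrincipalIdealRing 𝒪[K]]`).  Cell `pub/hodgecm-mathlib` (D-0151),
crux H413; road «S3-ram» (Literature seeding, count-neutral); (T2) G-side organ (Cnt2′), organ (z1-c) «TUBE LAYERS b ≥ 1», PART II(b=1) «COLLAR TOKENS» (★ p848616 K0–K3, ★
p848891 K4, ★ the GATE), here in the CHILD currency of the census machines (★ `ncard_fixedGrandchildren_eq_mul_ncard_passingChildren`, ★ `ncard_neighborSet_pred_eq_natCard`: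
grandchildren are counted `q` at a time through the children `c`, with a predicate on the residue of `ϖ^{−d}⟨x_c, M x_c⟩` for the child's isotropic vector `x_c`) — for
ROUTE B's region census (keeper F0P2-p02 (g14), «J2-POOL» F0P3a-p02 (g18)) and the (z2) finite-field collar census (★ `DepthZeroKappaTransferTypeTwoRamifiedCollarCensus`:
«the `q` gluings along one line all carry the line's label»).
BLOCK CURRENCY: `H = !![H₂ 0 0, 0, H₂ 0 1; 0, h, 0; H₂ 1 0, 0, H₂ 1 1]`, `Γ = ι(γ₂, u) = endoGL (γ₂, u)`, `v = latt ι(g, 1)` a SELF-DUAL AXIS vertex (`latt g` self-dual for `H₂`),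
`x ∈ v` NON-AXIAL (`|x(1)| = 1`), its child `c_x := {m ∈ v : |⟨x, m⟩| ≤ |ϖ|}` (`ϖv ≤ c_x`, `[v : c_x] = q`; a tree vertex iff `x̄` is isotropic), and a self-dual `w` HANGING
BELOW `c_x`: `c_x ≤ w`, `ϖ·w ≤ v`, `w ≰ v`.

THE MATHEMATICS.  (1) VALUE CONGRUENCE (§1, any integral lattice `v` with `(Γ−1)v ⊆ ϖ^D v`): `x′ ≡ x (mod ϖv)` ⇒ `ϖ^{−D}⟨x′,(Γ−1)x′⟩ ≡ ϖ^{−D}⟨x,(Γ−1)x⟩ (mod 𝔪)` — the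
cross terms are `ϖ·ϖ^D`-small.  (2) GENERATOR OF A HANGING LATTICE (§2): pick `y ∈ w ∖ v`; `n := ϖy ∈ v ∖ ϖv` pairs into `ϖ𝒪` with all of `c_x ⊆ w = w^#`; since `v = c_x +
𝒪e₁` (`⟨x, e₁⟩ = σ(x(1))h` is a unit) the vector `n − a·x`, `a := n(1)∕x(1)`, pairs into `ϖ𝒪` with ALL of `v = v^#`, i.e. `n ≡ a·x (mod ϖv)`, and `a` is a unit (else `y ∈ v`);
so `x₀ := a⁻¹y ∈ w` has `ϖx₀ ≡ x (mod ϖv)` and `|x₀(1)| = |ϖ|⁻¹`; pairing `x₀` with `e₁` shows `e₁ ∉ w`, so `w` has TUBE COORDINATE `1` with generator `x₀`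
(`exists_generator_of_hanging`), and by the GATE `A(w) = v`.  (3) THE CHILD-LINE LAW (§3): with `(Γ − 1)v ⊆ ϖ^D v`, `D ≥ 2`, `Γ` unitary: EVERY self-dual `w` hanging below
`c_x` is `Γ`-fixed with `LEV[w](ϖ^{D−2})`, and **`LEV[w](ϖ^{D−1}) ⟺ |ϖ^{−D}⟨x, (Γ−1)x⟩| < 1`** (★ K2 + (1)); if that residue `t(x)` is a unit, the depth-`(D−2)` class of `w` is the
class of `−t(x)` (★ K3 + (1)); and `LEV[w](ϖ^D) ⇒ (Γ − u₀₀·1)x ∈ ϖ^{D+1}v` (★ K4: the region members below `c_x` exist only on the eigenlines; WHICH of the `q` lattices below such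
a `c_x` lie in the region depends on two further digits of their own value, ★ K4).  So the label is CONSTANT on the `q` self-dual lattices below each non-axial child — the
lattice half of «`q` gluings per collar line».

* §1 `v_inv_pow_mul_pairing_sub_le_of_eq_add_smul` (value congruence).
* §2 **`exists_generator_of_hanging`** (tube coordinate `1`, generator `x₀ ∈ w` with `ϖx₀ − x ∈ ϖv`), `axisVertex_eq_of_hanging` (`A(w) = v`).
* §3 **`hanging_fixed_and_lev_iff`** (fixed, `LEV(ϖ^{D−2})`, `LEV(ϖ^{D−1}) ⟺ |t(x)| < 1`), **`hanging_class_iff`** (class `⟺ −t(x)`), **`hanging_levTop_imp`**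
  (`LEV(ϖ^D) ⇒ (Γ − u₀₀·1)x ∈ ϖ^{D+1}v ∧ |t(x)| < 1`).

HONEST LABEL: HC_CM is proved only modulo the 2 remaining named inputs (hLiu418 24832, h413 24833) until rung 0 closes; nothing printed is asserted here (elementary lattice
algebra over a discretely valued field); «S3-ram» has no books consequence.

## References
* [Kottwitz1986] R. E. Kottwitz, *Base change for unit elements of Hecke algebras*, Compositio Math. 60 (1986), §3 (counting fixed lattices shell by shell through children).
* [Rogawski1990] J. D. Rogawski, *Automorphic Representations of Unitary Groups in Three Variables*, Ann. of Math. Stud. 123 (1990), §4.8 Case (a) p. 53, §4.9 p. 55.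
* [BruhatTits1972] F. Bruhat, J. Tits, *Groupes réductifs sur un corps local I*, Publ. Math. IHÉS 41 (1972), §10 (lattice models; neighbours through isotropic lines).
* [Serre1980Trees] J.-P. Serre, *Trees* (1980), Ch. II §1.1 (neighbours of a lattice).
-/

set_option autoImplicit false

noncomputable section

open scoped Valued WithZero Matrix MatrixGroups

namespace Literature.NumberTheory.Automorphic.UnitaryLatticeTree

open Literature.NumberTheory.Automorphic Literature.NumberTheory.Automorphic.HermitianLattice Literature.NumberTheory.Rogawski1990

variable {K : Type*} [Field K] [Valued K ℤᵐ⁰]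

/-! ## §1 VALUE CONGRUENCE: `x′ ≡ x (mod ϖv)` ⇒ `ϖ^{−D}⟨x′, Yx′⟩ ≡ ϖ^{−D}⟨x, Yx⟩ (mod 𝔪)` -/

/-- **Value congruence.**  `v` an INTEGRAL lattice (`⟨v, v⟩ ⊆ 𝒪`) with `Y·v ⊆ ϖ^D·v`; `x ∈ v`, `y ∈ v`, `x′ = x + ϖy`.  Then `|ϖ^{−D}(⟨x′, Yx′⟩ − ⟨x, Yx⟩)| ≤ |ϖ|` — the value
`ϖ^{−D}⟨x, Yx⟩` is constant modulo `𝔪` on `x + ϖv`. [cite: Kottwitz1986, §3] [cite: Rogawski1990, §4.9 p. 55] -/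
theorem v_inv_pow_mul_pairing_sub_le_of_eq_add_smul {N : ℕ} (σ : K →+* K) (hvσ : ∀ a, Valued.v (σ a) = Valued.v a) {ϖ : K} (hϖ0 : ϖ ≠ 0) (hϖ1 : Valued.v ϖ ≤ 1)
    {H : Matrix (Fin N) (Fin N) K} {v : Submodule 𝒪[K] (Fin N → K)} (hvint : ∀ a ∈ v, ∀ b ∈ v, Valued.v (pairing σ H a b) ≤ 1)
    (Y : Matrix (Fin N) (Fin N) K) {D : ℕ} (hY : ∀ a ∈ v, Y *ᵥ a ∈ scaleLattice (ϖ ^ D) v)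
    {x y x' : Fin N → K} (hx : x ∈ v) (hy : y ∈ v) (hx' : x' = x + ϖ • y) :
    Valued.v ((ϖ ^ D)⁻¹ * (pairing σ H x' (Y *ᵥ x') - pairing σ H x (Y *ᵥ x))) ≤ Valued.v ϖ := by
  have hϖD0 : ϖ ^ D ≠ 0 := pow_ne_zero _ hϖ0
  have hvϖD0 : Valued.v ϖ ^ D ≠ 0 := pow_ne_zero _ ((Valuation.ne_zero_iff _).2 hϖ0)
  -- `ϖ^{-D}·⟨a, Y b⟩` is integral for `a, b ∈ v`
  have hint : ∀ a ∈ v, ∀ b ∈ v, Valued.v ((ϖ ^ D)⁻¹ * pairing σ H a (Y *ᵥ b)) ≤ 1 := fun a ha b hb => by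
    have hYb := hY b hb
    rw [mem_scaleLattice_iff hϖD0] at hYb
    have e : (ϖ ^ D)⁻¹ * pairing σ H a (Y *ᵥ b) = pairing σ H a ((ϖ ^ D)⁻¹ • (Y *ᵥ b)) := by rw [LinearMap.map_smul, smul_eq_mul]
    rw [e]; exact hvint a ha _ hYb
  -- expand
  have e : (ϖ ^ D)⁻¹ * (pairing σ H x' (Y *ᵥ x') - pairing σ H x (Y *ᵥ x)) =
      ϖ * ((ϖ ^ D)⁻¹ * pairing σ H x (Y *ᵥ y)) + σ ϖ * ((ϖ ^ D)⁻¹ * pairing σ H y (Y *ᵥ x)) + σ ϖ * ϖ * ((ϖ ^ D)⁻¹ * pairing σ H y (Y *ᵥ y)) := by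
    rw [hx', Matrix.mulVec_add, Matrix.mulVec_smul]
    simp only [map_add, map_smulₛₗ, LinearMap.add_apply, LinearMap.smul_apply, smul_eq_mul, RingHom.id_apply]
    ring
  rw [e]
  refine (Valuation.map_add _ _ _).trans (max_le ((Valuation.map_add _ _ _).trans (max_le ?_ ?_)) ?_)
  · rw [map_mul]; exact (mul_le_mul' le_rfl (hint x hx y hy)).trans (le_of_eq (mul_one _))
  · rw [map_mul, hvσ]; exact (mul_le_mul' le_rfl (hint y hy x hx)).trans (le_of_eq (mul_one _))
  · rw [map_mul, map_mul, hvσ]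
    exact (mul_le_mul' (mul_le_mul' le_rfl hϖ1) (hint y hy y hy)).trans (le_of_eq (by rw [mul_one, mul_one]))

/-! ## §2 THE GENERATOR OF A SELF-DUAL LATTICE HANGING BELOW A NON-AXIAL CHILD -/

/-- **Generator of a hanging lattice.**  `v = latt ι(g,1)` a self-dual axis vertex, `x ∈ v` with `|x(1)| = 1` (non-axial), `w` self-dual with `c_x = {m ∈ v : |⟨x,m⟩| ≤ |ϖ|} ⊆ w`,
`ϖ·w ⊆ v`, `w ⊄ v`.  Then `w` has TUBE COORDINATE `1` and a generator `x₀ ∈ w` (`|x₀(1)|·|ϖ| = 1`) with `ϖ·x₀ − x ∈ ϖ·v` — the `q` self-dual lattices below the child `c_x` are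
all glued along (lifts of) the SAME residual line `x̄`. [cite: Kottwitz1986, §3] [cite: BruhatTits1972, §10] [cite: Serre1980Trees, II.1.1] -/
theorem exists_generator_of_hanging (σ : K →+* K) (hσ : ∀ a, σ (σ a) = a) (hvσ : ∀ a, Valued.v (σ a) = Valued.v a)
    {ϖ : K} (hϖ : Valued.v ϖ = WithZero.exp (-1 : ℤ))
    {H₂ : Matrix (Fin 2) (Fin 2) K} (hH₂ : IsUnit H₂.det) (hH₂σ : (H₂.map σ)ᵀ = H₂) {h : K} (hh : Valued.v h = 1) (hhσ : σ h = h)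
    {g : GL (Fin 2) K} (hg : IsSelfDualLattice σ ϖ H₂ (latt (g : Matrix (Fin 2) (Fin 2) K)))
    {x : Fin 3 → K} (hx : x ∈ latt ((endoGL (g, (1 : GL (Fin 1) K)) : GL (Fin 3) K) : Matrix (Fin 3) (Fin 3) K)) (hx1 : Valued.v (x 1) = 1)
    {w : Submodule 𝒪[K] (Fin 3 → K)} (hw : IsSelfDualLattice σ ϖ (!![H₂ 0 0, 0, H₂ 0 1; 0, h, 0; H₂ 1 0, 0, H₂ 1 1] : Matrix (Fin 3) (Fin 3) K) w)
    (hcx : ∀ m ∈ latt ((endoGL (g, (1 : GL (Fin 1) K)) : GL (Fin 3) K) : Matrix (Fin 3) (Fin 3) K), Valued.v (pairing σ (!![H₂ 0 0, 0, H₂ 0 1; 0, h, 0; H₂ 1 0, 0, H₂ 1 1] : Matrix (Fin 3) (Fin 3) K) x m) ≤ Valued.v ϖ → m ∈ w)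
    (hwv : scaleLattice (ϖ ^ 1) w ≤ latt ((endoGL (g, (1 : GL (Fin 1) K)) : GL (Fin 3) K) : Matrix (Fin 3) (Fin 3) K)) (hnle : ¬ w ≤ latt ((endoGL (g, (1 : GL (Fin 1) K)) : GL (Fin 3) K) : Matrix (Fin 3) (Fin 3) K)) :
    (∀ c : K, (Pi.single 1 c : Fin 3 → K) ∈ w ↔ Valued.v c ≤ Valued.v ϖ ^ 1) ∧
      ∃ x₀ ∈ w, Valued.v (x₀ 1) * Valued.v ϖ ^ 1 = 1 ∧ ϖ • x₀ - x ∈ scaleLattice (ϖ ^ 1) (latt ((endoGL (g, (1 : GL (Fin 1) K)) : GL (Fin 3) K) : Matrix (Fin 3) (Fin 3) K)) := by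
  have hϖ0' : Valued.v ϖ ≠ 0 := by rw [hϖ]; exact WithZero.exp_ne_zero
  have hϖ0 : ϖ ≠ 0 := fun h0 => by rw [h0, map_zero] at hϖ0'; exact hϖ0' rfl
  have hϖlt : Valued.v ϖ < 1 := by rw [hϖ, ← WithZero.exp_zero, WithZero.exp_lt_exp]; omega
  have hϖ1 : Valued.v ϖ ≤ 1 := hϖlt.le
  have hϖ10 : ϖ ^ 1 ≠ 0 := pow_ne_zero _ hϖ0
  have hh0 : h ≠ 0 := fun h0 => by rw [h0, map_zero] at hh; exact zero_ne_one hh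
  have hx10 : x 1 ≠ 0 := fun h0 => by rw [h0, map_zero] at hx1; exact zero_ne_one hx1
  -- `|y| < 1 ⟺ |y| ≤ |ϖ|`
  have hlt_iff : ∀ y : K, Valued.v y < 1 ↔ Valued.v y ≤ Valued.v ϖ := fun y => by
    rw [hϖ]
    constructor
    · intro hy
      by_cases h0 : Valued.v y = 0
      · rw [h0]; exact zero_le
      · rw [← WithZero.exp_log h0, ← WithZero.exp_zero, WithZero.exp_lt_exp] at hy
        rw [← WithZero.exp_log h0, WithZero.exp_le_exp]; omega
    · intro hy; exact lt_of_le_of_lt hy (by rw [← WithZero.exp_zero, WithZero.exp_lt_exp]; omega)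
  -- the two self-dual lattices are integral
  have hL : IsSelfDualLattice σ ϖ (!![H₂ 0 0, 0, H₂ 0 1; 0, h, 0; H₂ 1 0, 0, H₂ 1 1] : Matrix (Fin 3) (Fin 3) K) (latt ((endoGL (g, (1 : GL (Fin 1) K)) : GL (Fin 3) K) : Matrix (Fin 3) (Fin 3) K)) := (isSelfDualLattice_latt_endoGL_one_iff σ hvσ hϖ0 hϖ1 H₂ hh g).2 hg
  have hLeq := dualLatt_eq_self_of_isSelfDualLattice hvσ (isUnit_det_endoShapeForm hH₂ hh) hL
  have hLd : ∀ a ∈ latt ((endoGL (g, (1 : GL (Fin 1) K)) : GL (Fin 3) K) : Matrix (Fin 3) (Fin 3) K), ∀ b ∈ latt ((endoGL (g, (1 : GL (Fin 1) K)) : GL (Fin 3) K) : Matrix (Fin 3) (Fin 3) K), Valued.v (pairing σ (!![H₂ 0 0, 0, H₂ 0 1; 0, h, 0; H₂ 1 0, 0, H₂ 1 1] : Matrix (Fin 3) (Fin 3) K) a b) ≤ 1 := fun a ha b hb =>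
    (mem_dualLatt σ _ _ b).1 (by rw [hLeq]; exact hb) a ha
  have hwd : ∀ a ∈ w, ∀ b ∈ w, Valued.v (pairing σ (!![H₂ 0 0, 0, H₂ 0 1; 0, h, 0; H₂ 1 0, 0, H₂ 1 1] : Matrix (Fin 3) (Fin 3) K) a b) ≤ 1 := fun a ha b hb =>
    (mem_dualLatt σ _ _ b).1 (le_dualLatt_of_isVertexLattice hvσ hw hb) a ha
  -- coordinates in `v = latt ι(g,1)`: `|m(1)| ≤ 1`, `e₁ ∈ v`
  have hL1 : ∀ m ∈ latt ((endoGL (g, (1 : GL (Fin 1) K)) : GL (Fin 3) K) : Matrix (Fin 3) (Fin 3) K), Valued.v (m 1) ≤ 1 := fun m hm => ((mem_latt_endoGL_one_iff g m).1 hm).2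
  have hsingle : ∀ c : K, (Pi.single 1 c : Fin 3 → K) ∈ latt ((endoGL (g, (1 : GL (Fin 1) K)) : GL (Fin 3) K) : Matrix (Fin 3) (Fin 3) K) ↔ Valued.v c ≤ 1 := fun c => by
    rw [mem_latt_endoGL_one_iff]
    have e : (![(Pi.single 1 c : Fin 3 → K) 0, (Pi.single 1 c : Fin 3 → K) 2] : Fin 2 → K) = 0 := by
      ext i; fin_cases i <;> simp
    rw [e]; simp
  -- pairings with `e₁`-multiples
  have hrow := endoShapeForm_row H₂ h
  have hcol := endoShapeForm_col H₂ h
  have hpe : ∀ (m : Fin 3 → K) (c : K), pairing σ (!![H₂ 0 0, 0, H₂ 0 1; 0, h, 0; H₂ 1 0, 0, H₂ 1 1] : Matrix (Fin 3) (Fin 3) K) m (Pi.single 1 c) = σ (m 1) * h * c := fun m c => by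
    rw [pairing_single_right_of_block σ _ 1 hcol]; rfl
  have hep : ∀ (c : K) (m : Fin 3 → K), pairing σ (!![H₂ 0 0, 0, H₂ 0 1; 0, h, 0; H₂ 1 0, 0, H₂ 1 1] : Matrix (Fin 3) (Fin 3) K) (Pi.single 1 c) m = σ c * h * m 1 := fun c m => by
    rw [pairing_single_left_of_block σ _ 1 hrow]; rfl
  -- `ϖ·v ⊆ c_x ⊆ w`
  have hϖL : scaleLattice (ϖ ^ 1) (latt ((endoGL (g, (1 : GL (Fin 1) K)) : GL (Fin 3) K) : Matrix (Fin 3) (Fin 3) K)) ≤ w := fun m hm => by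
    rw [mem_scaleLattice_iff hϖ10] at hm
    have e : m = (ϖ ^ 1) • ((ϖ ^ 1)⁻¹ • m) := by rw [smul_smul, mul_inv_cancel₀ hϖ10, one_smul]
    have hmL : m ∈ latt ((endoGL (g, (1 : GL (Fin 1) K)) : GL (Fin 3) K) : Matrix (Fin 3) (Fin 3) K) := by rw [e]; exact smul_mem_of_v_le _ (by rw [map_pow]; exact pow_le_one₀ zero_le hϖ1) hm
    refine hcx m hmL ?_
    rw [e, LinearMap.map_smul, smul_eq_mul, map_mul, map_pow, pow_one]
    exact (mul_le_mul' le_rfl (hLd x hx _ hm)).trans (le_of_eq (mul_one _))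
  -- a vector of `w` outside `v`
  obtain ⟨y, hyw, hyL⟩ := Set.not_subset.1 (show ¬ ((w : Set (Fin 3 → K)) ⊆ latt ((endoGL (g, (1 : GL (Fin 1) K)) : GL (Fin 3) K) : Matrix (Fin 3) (Fin 3) K)) from hnle)
  have hnL : ϖ • y ∈ latt ((endoGL (g, (1 : GL (Fin 1) K)) : GL (Fin 3) K) : Matrix (Fin 3) (Fin 3) K) := hwv ((mem_scaleLattice_iff hϖ10 _ _).2 (by rw [pow_one, smul_smul, inv_mul_cancel₀ hϖ0, one_smul]; exact hyw))
  -- `a := (ϖy)(1) ∕ x(1)`, `n′ := ϖy − a•x ∈ ϖ·v`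
  obtain ⟨a, ha⟩ : ∃ a : K, a = (ϖ • y) 1 / x 1 := ⟨_, rfl⟩
  have ha1 : Valued.v a ≤ 1 := by
    rw [ha, map_div₀, hx1, div_one]; exact hL1 _ hnL
  have hya : (ϖ • y) 1 = a * x 1 := by rw [ha, div_mul_cancel₀ _ hx10]
  have hya' : ϖ * y 1 = a * x 1 := by simpa only [Pi.smul_apply, smul_eq_mul] using hya
  have hn'1 : (ϖ • y - a • x) 1 = 0 := by
    rw [Pi.sub_apply, hya, Pi.smul_apply, smul_eq_mul, sub_self]
  have hn'L : ϖ • y - a • x ∈ scaleLattice (ϖ ^ 1) (latt ((endoGL (g, (1 : GL (Fin 1) K)) : GL (Fin 3) K) : Matrix (Fin 3) (Fin 3) K)) := by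
    rw [mem_scaleLattice_iff hϖ10, ← hLeq, mem_dualLatt]
    intro m hm
    -- `m = (m − b e₁) + b e₁` with `m − b e₁ ∈ c_x`
    obtain ⟨b, hb⟩ : ∃ b : K, b = pairing σ (!![H₂ 0 0, 0, H₂ 0 1; 0, h, 0; H₂ 1 0, 0, H₂ 1 1] : Matrix (Fin 3) (Fin 3) K) x m / pairing σ (!![H₂ 0 0, 0, H₂ 0 1; 0, h, 0; H₂ 1 0, 0, H₂ 1 1] : Matrix (Fin 3) (Fin 3) K) x (Pi.single 1 1) := ⟨_, rfl⟩
    have hxe : pairing σ (!![H₂ 0 0, 0, H₂ 0 1; 0, h, 0; H₂ 1 0, 0, H₂ 1 1] : Matrix (Fin 3) (Fin 3) K) x (Pi.single 1 1) = σ (x 1) * h := by rw [hpe, mul_one]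
    have hxe0 : pairing σ (!![H₂ 0 0, 0, H₂ 0 1; 0, h, 0; H₂ 1 0, 0, H₂ 1 1] : Matrix (Fin 3) (Fin 3) K) x (Pi.single 1 1) ≠ 0 := by
      rw [hxe]; exact mul_ne_zero (fun h0 => hx10 (by rw [← hσ (x 1), h0, map_zero])) hh0
    have hb1 : Valued.v b ≤ 1 := by
      rw [hb, map_div₀, hxe, map_mul, hvσ, hx1, hh, one_mul, div_one]; exact hLd x hx m hm
    have hcm : m - b • (Pi.single 1 1 : Fin 3 → K) ∈ w := by
      refine hcx _ (Submodule.sub_mem _ hm (smul_mem_of_v_le _ hb1 ((hsingle 1).2 (by rw [map_one])))) ?_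
      rw [LinearMap.map_sub, LinearMap.map_smul, smul_eq_mul, hb, div_mul_cancel₀ _ hxe0, sub_self, map_zero]
      exact zero_le
    -- pair `ϖ⁻¹ n′` with both pieces
    have e : pairing σ (!![H₂ 0 0, 0, H₂ 0 1; 0, h, 0; H₂ 1 0, 0, H₂ 1 1] : Matrix (Fin 3) (Fin 3) K) m ((ϖ ^ 1)⁻¹ • (ϖ • y - a • x)) =
        pairing σ (!![H₂ 0 0, 0, H₂ 0 1; 0, h, 0; H₂ 1 0, 0, H₂ 1 1] : Matrix (Fin 3) (Fin 3) K) (m - b • (Pi.single 1 1 : Fin 3 → K)) ((ϖ ^ 1)⁻¹ • (ϖ • y - a • x)) +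
          σ b * pairing σ (!![H₂ 0 0, 0, H₂ 0 1; 0, h, 0; H₂ 1 0, 0, H₂ 1 1] : Matrix (Fin 3) (Fin 3) K) (Pi.single 1 1 : Fin 3 → K) ((ϖ ^ 1)⁻¹ • (ϖ • y - a • x)) := by
      rw [← smul_eq_mul, ← LinearMap.smul_apply, ← LinearMap.map_smulₛₗ, ← LinearMap.add_apply, ← LinearMap.map_add, sub_add_cancel]
    rw [e]
    refine (Valuation.map_add _ _ _).trans (max_le ?_ ?_)
    · -- against `c_x`: `⟨c, y⟩ ∈ 𝒪`, `⟨c, x⟩ ∈ ϖ𝒪`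
      rw [LinearMap.map_smul, smul_eq_mul, LinearMap.map_sub, LinearMap.map_smul, LinearMap.map_smul, smul_eq_mul, smul_eq_mul, pow_one, mul_sub, ← mul_assoc,
        inv_mul_cancel₀ hϖ0, one_mul]
      refine (Valuation.map_sub _ _ _).trans (max_le (hwd _ hcm y hyw) ?_)
      rw [map_mul, map_mul, map_inv₀]
      have hcxx : Valued.v (pairing σ (!![H₂ 0 0, 0, H₂ 0 1; 0, h, 0; H₂ 1 0, 0, H₂ 1 1] : Matrix (Fin 3) (Fin 3) K) (m - b • (Pi.single 1 1 : Fin 3 → K)) x) ≤ Valued.v ϖ := by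
        rw [v_pairing_comm_of_hermitian hvσ hσ (endoShapeForm_hermitian hH₂σ hhσ)]
        rw [LinearMap.map_sub, LinearMap.map_smul, smul_eq_mul, hb, div_mul_cancel₀ _ hxe0, sub_self, map_zero]
        exact zero_le
      calc (Valued.v ϖ)⁻¹ * (Valued.v a * Valued.v (pairing σ (!![H₂ 0 0, 0, H₂ 0 1; 0, h, 0; H₂ 1 0, 0, H₂ 1 1] : Matrix (Fin 3) (Fin 3) K) (m - b • (Pi.single 1 1 : Fin 3 → K)) x))
          ≤ (Valued.v ϖ)⁻¹ * (1 * Valued.v ϖ) := mul_le_mul' le_rfl (mul_le_mul' ha1 hcxx)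
        _ = 1 := by rw [one_mul, inv_mul_cancel₀ hϖ0']
    · -- against `e₁`: `n′(1) = 0`
      rw [hep, Pi.smul_apply, hn'1, smul_zero, mul_zero, mul_zero, map_zero]
      exact zero_le
  -- `a` is a unit (else `y ∈ v`)
  have hau : Valued.v a = 1 := by
    by_contra hne
    have hlt : Valued.v a < 1 := lt_of_le_of_ne ha1 hne
    apply hyL
    have haxL : a • x ∈ scaleLattice (ϖ ^ 1) (latt ((endoGL (g, (1 : GL (Fin 1) K)) : GL (Fin 3) K) : Matrix (Fin 3) (Fin 3) K)) := by
      rw [mem_scaleLattice_iff hϖ10, smul_smul]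
      exact smul_mem_of_v_le _ (by rw [map_mul, map_inv₀, map_pow, pow_one, inv_mul_le_iff₀ (zero_lt_iff.2 hϖ0'), mul_one]; exact (hlt_iff a).1 hlt) hx
    have hϖy : ϖ • y ∈ scaleLattice (ϖ ^ 1) (latt ((endoGL (g, (1 : GL (Fin 1) K)) : GL (Fin 3) K) : Matrix (Fin 3) (Fin 3) K)) := by
      have := Submodule.add_mem _ hn'L haxL
      rwa [sub_add_cancel] at this
    rw [mem_scaleLattice_iff hϖ10, pow_one, smul_smul, inv_mul_cancel₀ hϖ0, one_smul] at hϖy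
    exact hϖy
  have ha0 : a ≠ 0 := fun h0 => by rw [h0, map_zero] at hau; exact zero_ne_one hau
  -- the generator `x₀ := a⁻¹ y`
  have hx₀w : a⁻¹ • y ∈ w := smul_mem_of_v_le _ (by rw [map_inv₀, hau, inv_one]) hyw
  have hx₀1 : Valued.v ((a⁻¹ • y) 1) * Valued.v ϖ ^ 1 = 1 := by
    have e2 : (a⁻¹ • y) 1 * ϖ ^ 1 = x 1 := by
      rw [Pi.smul_apply, smul_eq_mul, pow_one, mul_assoc, mul_comm (y 1) ϖ, hya', ← mul_assoc, inv_mul_cancel₀ ha0, one_mul]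
    rw [← map_pow, ← map_mul, e2, hx1]
  have hcong : ϖ • (a⁻¹ • y) - x ∈ scaleLattice (ϖ ^ 1) (latt ((endoGL (g, (1 : GL (Fin 1) K)) : GL (Fin 3) K) : Matrix (Fin 3) (Fin 3) K)) := by
    have e : ϖ • (a⁻¹ • y) - x = a⁻¹ • (ϖ • y - a • x) := by
      simp only [smul_sub, smul_smul, inv_mul_cancel₀ ha0, one_smul, mul_comm ϖ a⁻¹]
    rw [e]; exact smul_mem_of_v_le _ (by rw [map_inv₀, hau, inv_one]) hn'L
  refine ⟨fun c => ⟨fun hc => ?_, fun hc => ?_⟩, a⁻¹ • y, hx₀w, hx₀1, hcong⟩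
  · -- `c e₁ ∈ w` pairs integrally with `x₀`, `|x₀(1)| = |ϖ|⁻¹`
    have h1 := hwd _ hc _ hx₀w
    rw [hep, map_mul, map_mul, hvσ, hh, mul_one] at h1
    have hx₀v : Valued.v ((a⁻¹ • y) 1) = (Valued.v ϖ ^ 1)⁻¹ := eq_inv_of_mul_eq_one_left hx₀1
    rw [hx₀v, mul_inv_le_iff₀ (zero_lt_iff.2 (pow_ne_zero _ hϖ0')), one_mul] at h1
    exact h1
  · refine hϖL ((mem_scaleLattice_iff hϖ10 _ _).2 ?_)
    have e : (ϖ ^ 1)⁻¹ • (Pi.single 1 c : Fin 3 → K) = Pi.single 1 ((ϖ ^ 1)⁻¹ * c) := by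
      ext k; rcases eq_or_ne k 1 with rfl | hk <;> simp [*]
    rw [e, hsingle, map_mul, map_inv₀, map_pow, inv_mul_le_iff₀ (zero_lt_iff.2 (pow_ne_zero _ hϖ0')), mul_one]
    exact hc

/-- `A(w) = v` for a self-dual `w` hanging below a non-axial child of the self-dual axis vertex `v = latt ι(g,1)` (★ THE GATE + `exists_generator_of_hanging`).
[cite: Kottwitz1986, §3] [cite: BruhatTits1972, §10] -/
theorem axisVertex_eq_of_hanging [IsPrincipalIdealRing 𝒪[K]] (σ : K →+* K) (hσ : ∀ a, σ (σ a) = a) (hvσ : ∀ a, Valued.v (σ a) = Valued.v a)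
    {ϖ : K} (hϖ : Valued.v ϖ = WithZero.exp (-1 : ℤ))
    {H₂ : Matrix (Fin 2) (Fin 2) K} (hH₂ : IsUnit H₂.det) (hH₂σ : (H₂.map σ)ᵀ = H₂) {h : K} (hh : Valued.v h = 1) (hhσ : σ h = h)
    {g : GL (Fin 2) K} (hg : IsSelfDualLattice σ ϖ H₂ (latt (g : Matrix (Fin 2) (Fin 2) K)))
    {x : Fin 3 → K} (hx : x ∈ latt ((endoGL (g, (1 : GL (Fin 1) K)) : GL (Fin 3) K) : Matrix (Fin 3) (Fin 3) K)) (hx1 : Valued.v (x 1) = 1)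
    {w : Submodule 𝒪[K] (Fin 3 → K)} (hw : IsSelfDualLattice σ ϖ (!![H₂ 0 0, 0, H₂ 0 1; 0, h, 0; H₂ 1 0, 0, H₂ 1 1] : Matrix (Fin 3) (Fin 3) K) w)
    (hcx : ∀ m ∈ latt ((endoGL (g, (1 : GL (Fin 1) K)) : GL (Fin 3) K) : Matrix (Fin 3) (Fin 3) K), Valued.v (pairing σ (!![H₂ 0 0, 0, H₂ 0 1; 0, h, 0; H₂ 1 0, 0, H₂ 1 1] : Matrix (Fin 3) (Fin 3) K) x m) ≤ Valued.v ϖ → m ∈ w)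
    (hwv : scaleLattice (ϖ ^ 1) w ≤ latt ((endoGL (g, (1 : GL (Fin 1) K)) : GL (Fin 3) K) : Matrix (Fin 3) (Fin 3) K)) (hnle : ¬ w ≤ latt ((endoGL (g, (1 : GL (Fin 1) K)) : GL (Fin 3) K) : Matrix (Fin 3) (Fin 3) K)) :
    w ⊓ LinearMap.ker ((LinearMap.proj (1 : Fin 3) : (Fin 3 → K) →ₗ[K] K).restrictScalars 𝒪[K]) ⊔ scaleLattice (ϖ ^ 1) w ⊔ Submodule.span 𝒪[K] {(Pi.single 1 1 : Fin 3 → K)} = latt ((endoGL (g, (1 : GL (Fin 1) K)) : GL (Fin 3) K) : Matrix (Fin 3) (Fin 3) K) := by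
  obtain ⟨hb, -⟩ := exists_generator_of_hanging σ hσ hvσ hϖ hH₂ hH₂σ hh hhσ hg hx hx1 hw hcx hwv hnle
  exact axisVertex_eq_latt_endoGL_of_scaleLattice_le σ hσ hvσ hϖ hH₂ hH₂σ hh hhσ hw hb hg hwv

/-! ## §3 THE CHILD-LINE LAW: the tokens of the `q` lattices below a non-axial child are read on the child's residue `ϖ^{−D}⟨x, (Γ−1)x⟩` -/

/-- **THE CHILD-LINE LAW (fixedness, levels).**  `v = latt ι(g,1)` a self-dual axis vertex with `(Γ − 1)v ⊆ ϖ^D v`, `D ≥ 2`; `x ∈ v` non-axial (`|x(1)| = 1`); `w` any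
self-dual lattice hanging below the child `c_x` (`c_x ⊆ w`, `ϖw ⊆ v`, `w ⊄ v`).  Then `Γ·w ⊆ w`, `LEV[w](ϖ^{D−2})`, and **`LEV[w](ϖ^{D−1}) ⟺ |ϖ^{−D}⟨x, (Γ − 1)x⟩| < 1`**
(★ K0–K2 `collar_fixed_and_lev_of_axisLevel` at the generator of §2 + the value congruence of §1).  The right-hand side depends on the CHILD only.
[cite: Kottwitz1986, §3] [cite: Rogawski1990, §4.9 p. 55] -/
theorem hanging_fixed_and_lev_iff [IsPrincipalIdealRing 𝒪[K]] (σ : K →+* K) (hσ : ∀ a, σ (σ a) = a) (hvσ : ∀ a, Valued.v (σ a) = Valued.v a)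
    {ϖ : K} (hϖ : Valued.v ϖ = WithZero.exp (-1 : ℤ))
    {H₂ : Matrix (Fin 2) (Fin 2) K} (hH₂ : IsUnit H₂.det) (hH₂σ : (H₂.map σ)ᵀ = H₂) {h : K} (hh : Valued.v h = 1) (hhσ : σ h = h)
    {g : GL (Fin 2) K} (hg : IsSelfDualLattice σ ϖ H₂ (latt (g : Matrix (Fin 2) (Fin 2) K)))
    (γ₂ : GL (Fin 2) K) (u : GL (Fin 1) K) {D : ℕ} (hD : 2 ≤ D)
    (hlev : ∀ a ∈ latt ((endoGL (g, (1 : GL (Fin 1) K)) : GL (Fin 3) K) : Matrix (Fin 3) (Fin 3) K), (((endoGL (γ₂, u) : GL (Fin 3) K) : Matrix (Fin 3) (Fin 3) K) - 1) *ᵥ a ∈ scaleLattice (ϖ ^ D) (latt ((endoGL (g, (1 : GL (Fin 1) K)) : GL (Fin 3) K) : Matrix (Fin 3) (Fin 3) K)))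
    {x : Fin 3 → K} (hx : x ∈ latt ((endoGL (g, (1 : GL (Fin 1) K)) : GL (Fin 3) K) : Matrix (Fin 3) (Fin 3) K)) (hx1 : Valued.v (x 1) = 1)
    {w : Submodule 𝒪[K] (Fin 3 → K)} (hw : IsSelfDualLattice σ ϖ (!![H₂ 0 0, 0, H₂ 0 1; 0, h, 0; H₂ 1 0, 0, H₂ 1 1] : Matrix (Fin 3) (Fin 3) K) w)
    (hcx : ∀ m ∈ latt ((endoGL (g, (1 : GL (Fin 1) K)) : GL (Fin 3) K) : Matrix (Fin 3) (Fin 3) K), Valued.v (pairing σ (!![H₂ 0 0, 0, H₂ 0 1; 0, h, 0; H₂ 1 0, 0, H₂ 1 1] : Matrix (Fin 3) (Fin 3) K) x m) ≤ Valued.v ϖ → m ∈ w)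
    (hwv : scaleLattice (ϖ ^ 1) w ≤ latt ((endoGL (g, (1 : GL (Fin 1) K)) : GL (Fin 3) K) : Matrix (Fin 3) (Fin 3) K)) (hnle : ¬ w ≤ latt ((endoGL (g, (1 : GL (Fin 1) K)) : GL (Fin 3) K) : Matrix (Fin 3) (Fin 3) K)) :
    mapGL (endoGL (γ₂, u)) w ≤ w ∧
    (∀ y ∈ w, (((endoGL (γ₂, u) : GL (Fin 3) K) : Matrix (Fin 3) (Fin 3) K) - 1) *ᵥ y ∈ scaleLattice (ϖ ^ (D - 2)) w) ∧
    ((∀ y ∈ w, (((endoGL (γ₂, u) : GL (Fin 3) K) : Matrix (Fin 3) (Fin 3) K) - 1) *ᵥ y ∈ scaleLattice (ϖ ^ (D - 1)) w) ↔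
      Valued.v ((ϖ ^ D)⁻¹ * pairing σ (!![H₂ 0 0, 0, H₂ 0 1; 0, h, 0; H₂ 1 0, 0, H₂ 1 1] : Matrix (Fin 3) (Fin 3) K) x ((((endoGL (γ₂, u) : GL (Fin 3) K) : Matrix (Fin 3) (Fin 3) K) - 1) *ᵥ x)) < 1) := by
  have hϖ0' : Valued.v ϖ ≠ 0 := by rw [hϖ]; exact WithZero.exp_ne_zero
  have hϖ0 : ϖ ≠ 0 := fun h0 => by rw [h0, map_zero] at hϖ0'; exact hϖ0' rfl
  have hϖlt : Valued.v ϖ < 1 := by rw [hϖ, ← WithZero.exp_zero, WithZero.exp_lt_exp]; omega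
  have hϖ1 : Valued.v ϖ ≤ 1 := hϖlt.le
  have hϖ10 : ϖ ^ 1 ≠ 0 := pow_ne_zero _ hϖ0
  obtain ⟨hb, x₀, hx₀, hx₀1, hcong⟩ := exists_generator_of_hanging σ hσ hvσ hϖ hH₂ hH₂σ hh hhσ hg hx hx1 hw hcx hwv hnle
  have hA := axisVertex_eq_latt_endoGL_of_scaleLattice_le σ hσ hvσ hϖ hH₂ hH₂σ hh hhσ hw hb hg hwv
  have hAlev : ∀ a ∈ w ⊓ LinearMap.ker ((LinearMap.proj (1 : Fin 3) : (Fin 3 → K) →ₗ[K] K).restrictScalars 𝒪[K]) ⊔ scaleLattice (ϖ ^ 1) w ⊔ Submodule.span 𝒪[K] {(Pi.single 1 1 : Fin 3 → K)}, (((endoGL (γ₂, u) : GL (Fin 3) K) : Matrix (Fin 3) (Fin 3) K) - 1) *ᵥ a ∈ scaleLattice (ϖ ^ D) (w ⊓ LinearMap.ker ((LinearMap.proj (1 : Fin 3) : (Fin 3 → K) →ₗ[K] K).restrictScalars 𝒪[K]) ⊔ scaleLattice (ϖ ^ 1) w ⊔ Submodule.span 𝒪[K] {(Pi.single 1 1 :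 Fin 3 → K)}) := by rw [hA]; exact hlev
  obtain ⟨hfix, hlev2, hiff⟩ := collar_fixed_and_lev_of_axisLevel σ hσ hvσ hϖ hH₂ hH₂σ hh hhσ hw hb hx₀ hx₀1 γ₂ u hD hAlev
  refine ⟨hfix, hlev2, hiff.trans ?_⟩
  -- integrality of `v`
  have hL : IsSelfDualLattice σ ϖ (!![H₂ 0 0, 0, H₂ 0 1; 0, h, 0; H₂ 1 0, 0, H₂ 1 1] : Matrix (Fin 3) (Fin 3) K) (latt ((endoGL (g, (1 : GL (Fin 1) K)) : GL (Fin 3) K) : Matrix (Fin 3) (Fin 3) K)) := (isSelfDualLattice_latt_endoGL_one_iff σ hvσ hϖ0 hϖ1 H₂ hh g).2 hg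
  have hLeq := dualLatt_eq_self_of_isSelfDualLattice hvσ (isUnit_det_endoShapeForm hH₂ hh) hL
  have hLd : ∀ a ∈ latt ((endoGL (g, (1 : GL (Fin 1) K)) : GL (Fin 3) K) : Matrix (Fin 3) (Fin 3) K), ∀ b ∈ latt ((endoGL (g, (1 : GL (Fin 1) K)) : GL (Fin 3) K) : Matrix (Fin 3) (Fin 3) K), Valued.v (pairing σ (!![H₂ 0 0, 0, H₂ 0 1; 0, h, 0; H₂ 1 0, 0, H₂ 1 1] : Matrix (Fin 3) (Fin 3) K) a b) ≤ 1 := fun a ha b hb =>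
    (mem_dualLatt σ _ _ b).1 (by rw [hLeq]; exact hb) a ha
  -- `ϖx₀ = x + ϖ•y` with `y ∈ v`
  rw [mem_scaleLattice_iff hϖ10] at hcong
  have hxy : ϖ • x₀ = x + ϖ • ((ϖ ^ 1)⁻¹ • (ϖ • x₀ - x)) := by rw [smul_smul, pow_one, mul_inv_cancel₀ hϖ0, one_smul, add_sub_cancel]
  have hΔ := v_inv_pow_mul_pairing_sub_le_of_eq_add_smul σ hvσ hϖ0 hϖ1 hLd (((endoGL (γ₂, u) : GL (Fin 3) K) : Matrix (Fin 3) (Fin 3) K) - 1) hlev hx hcong hxy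
  -- ultrametric transfer
  rw [mul_sub] at hΔ
  have hΔ' := lt_of_le_of_lt hΔ hϖlt
  constructor
  · intro h0
    have e : (ϖ ^ D)⁻¹ * pairing σ (!![H₂ 0 0, 0, H₂ 0 1; 0, h, 0; H₂ 1 0, 0, H₂ 1 1] : Matrix (Fin 3) (Fin 3) K) x ((((endoGL (γ₂, u) : GL (Fin 3) K) : Matrix (Fin 3) (Fin 3) K) - 1) *ᵥ x) =
        (ϖ ^ D)⁻¹ * pairing σ (!![H₂ 0 0, 0, H₂ 0 1; 0, h, 0; H₂ 1 0, 0, H₂ 1 1] : Matrix (Fin 3) (Fin 3) K) (ϖ • x₀) ((((endoGL (γ₂, u) : GL (Fin 3) K) : Matrix (Fin 3) (Fin 3) K) - 1) *ᵥ (ϖ • x₀)) -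
          ((ϖ ^ D)⁻¹ * pairing σ (!![H₂ 0 0, 0, H₂ 0 1; 0, h, 0; H₂ 1 0, 0, H₂ 1 1] : Matrix (Fin 3) (Fin 3) K) (ϖ • x₀) ((((endoGL (γ₂, u) : GL (Fin 3) K) : Matrix (Fin 3) (Fin 3) K) - 1) *ᵥ (ϖ • x₀)) - (ϖ ^ D)⁻¹ * pairing σ (!![H₂ 0 0, 0, H₂ 0 1; 0, h, 0; H₂ 1 0, 0, H₂ 1 1] : Matrix (Fin 3) (Fin 3) K) x ((((endoGL (γ₂, u) : GL (Fin 3) K) : Matrix (Fin 3) (Fin 3) K) - 1) *ᵥ x)) := by ring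
    rw [e]; exact lt_of_le_of_lt (Valuation.map_sub _ _ _) (max_lt h0 hΔ')
  · intro h0
    have e : (ϖ ^ D)⁻¹ * pairing σ (!![H₂ 0 0, 0, H₂ 0 1; 0, h, 0; H₂ 1 0, 0, H₂ 1 1] : Matrix (Fin 3) (Fin 3) K) (ϖ • x₀) ((((endoGL (γ₂, u) : GL (Fin 3) K) : Matrix (Fin 3) (Fin 3) K) - 1) *ᵥ (ϖ • x₀)) =
        ((ϖ ^ D)⁻¹ * pairing σ (!![H₂ 0 0, 0, H₂ 0 1; 0, h, 0; H₂ 1 0, 0, H₂ 1 1] : Matrix (Fin 3) (Fin 3) K) (ϖ • x₀) ((((endoGL (γ₂, u) : GL (Fin 3) K) : Matrix (Fin 3) (Fin 3) K) - 1) *ᵥ (ϖ • x₀)) - (ϖ ^ D)⁻¹ * pairing σ (!![H₂ 0 0, 0, H₂ 0 1; 0, h, 0; H₂ 1 0, 0, H₂ 1 1] : Matrix (Fin 3) (Fin 3) K) x ((((endoGL (γ₂, u) : GL (Fin 3) K) : Matrix (Fin 3) (Fin 3) K) - 1) *ᵥ x)) +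
          (ϖ ^ D)⁻¹ * pairing σ (!![H₂ 0 0, 0, H₂ 0 1; 0, h, 0; H₂ 1 0, 0, H₂ 1 1] : Matrix (Fin 3) (Fin 3) K) x ((((endoGL (γ₂, u) : GL (Fin 3) K) : Matrix (Fin 3) (Fin 3) K) - 1) *ᵥ x) := by ring
    rw [e]; exact lt_of_le_of_lt (Valuation.map_add _ _ _) (max_lt hΔ' h0)

/-- **THE CHILD-LINE LAW (class).**  In the situation of `hanging_fixed_and_lev_iff`, if the child's residue `t(x) = ϖ^{−D}⟨x, (Γ−1)x⟩` is a UNIT (so `¬LEV[w](ϖ^{D−1})`: the `1±`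
lines), then the depth-`(D−2)` value form of EVERY self-dual `w` below `c_x` represents the unit class of `c₀` iff `−t(x)` lies in it (★ K3 `collar_class_iff_of_axisLevel` + §1).
[cite: Kottwitz1986, §3] [cite: Rogawski1990, §4.9 p. 55] -/
theorem hanging_class_iff [IsPrincipalIdealRing 𝒪[K]] (σ : K →+* K) (hσ : ∀ a, σ (σ a) = a) (hvσ : ∀ a, Valued.v (σ a) = Valued.v a)
    {ϖ : K} (hϖ : Valued.v ϖ = WithZero.exp (-1 : ℤ))
    {H₂ : Matrix (Fin 2) (Fin 2) K} (hH₂ : IsUnit H₂.det) (hH₂σ : (H₂.map σ)ᵀ = H₂) {h : K} (hh : Valued.v h = 1) (hhσ : σ h = h)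
    {g : GL (Fin 2) K} (hg : IsSelfDualLattice σ ϖ H₂ (latt (g : Matrix (Fin 2) (Fin 2) K)))
    (γ₂ : GL (Fin 2) K) (u : GL (Fin 1) K) {D : ℕ} (hD : 2 ≤ D)
    (hlev : ∀ a ∈ latt ((endoGL (g, (1 : GL (Fin 1) K)) : GL (Fin 3) K) : Matrix (Fin 3) (Fin 3) K), (((endoGL (γ₂, u) : GL (Fin 3) K) : Matrix (Fin 3) (Fin 3) K) - 1) *ᵥ a ∈ scaleLattice (ϖ ^ D) (latt ((endoGL (g, (1 : GL (Fin 1) K)) : GL (Fin 3) K) : Matrix (Fin 3) (Fin 3) K)))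
    {x : Fin 3 → K} (hx : x ∈ latt ((endoGL (g, (1 : GL (Fin 1) K)) : GL (Fin 3) K) : Matrix (Fin 3) (Fin 3) K)) (hx1 : Valued.v (x 1) = 1)
    {w : Submodule 𝒪[K] (Fin 3 → K)} (hw : IsSelfDualLattice σ ϖ (!![H₂ 0 0, 0, H₂ 0 1; 0, h, 0; H₂ 1 0, 0, H₂ 1 1] : Matrix (Fin 3) (Fin 3) K) w)
    (hcx : ∀ m ∈ latt ((endoGL (g, (1 : GL (Fin 1) K)) : GL (Fin 3) K) : Matrix (Fin 3) (Fin 3) K), Valued.v (pairing σ (!![H₂ 0 0, 0, H₂ 0 1; 0, h, 0; H₂ 1 0, 0, H₂ 1 1] : Matrix (Fin 3) (Fin 3) K) x m) ≤ Valued.v ϖ → m ∈ w)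
    (hwv : scaleLattice (ϖ ^ 1) w ≤ latt ((endoGL (g, (1 : GL (Fin 1) K)) : GL (Fin 3) K) : Matrix (Fin 3) (Fin 3) K)) (hnle : ¬ w ≤ latt ((endoGL (g, (1 : GL (Fin 1) K)) : GL (Fin 3) K) : Matrix (Fin 3) (Fin 3) K))
    (hres : ∀ z : K, Valued.v z ≤ 1 → Valued.v (σ z - z) < 1) (hσϖ : σ ϖ = -ϖ)
    (hunit : Valued.v ((ϖ ^ D)⁻¹ * pairing σ (!![H₂ 0 0, 0, H₂ 0 1; 0, h, 0; H₂ 1 0, 0, H₂ 1 1] : Matrix (Fin 3) (Fin 3) K) x ((((endoGL (γ₂, u) : GL (Fin 3) K) : Matrix (Fin 3) (Fin 3) K) - 1) *ᵥ x)) = 1) {c₀ : K} (hc₀ : Valued.v c₀ = 1) :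
    (∃ y ∈ w, ∃ a : K, Valued.v a = 1 ∧ Valued.v ((ϖ ^ (D - 2))⁻¹ * pairing σ (!![H₂ 0 0, 0, H₂ 0 1; 0, h, 0; H₂ 1 0, 0, H₂ 1 1] : Matrix (Fin 3) (Fin 3) K) y ((((endoGL (γ₂, u) : GL (Fin 3) K) : Matrix (Fin 3) (Fin 3) K) - 1) *ᵥ y) - c₀ * a ^ 2) < 1) ↔
      ∃ a : K, Valued.v a = 1 ∧ Valued.v ((ϖ ^ D)⁻¹ * pairing σ (!![H₂ 0 0, 0, H₂ 0 1; 0, h, 0; H₂ 1 0, 0, H₂ 1 1] : Matrix (Fin 3) (Fin 3) K) x ((((endoGL (γ₂, u) : GL (Fin 3) K) : Matrix (Fin 3) (Fin 3) K) - 1) *ᵥ x) + c₀ * a ^ 2) < 1 := by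
  have hϖ0' : Valued.v ϖ ≠ 0 := by rw [hϖ]; exact WithZero.exp_ne_zero
  have hϖ0 : ϖ ≠ 0 := fun h0 => by rw [h0, map_zero] at hϖ0'; exact hϖ0' rfl
  have hϖlt : Valued.v ϖ < 1 := by rw [hϖ, ← WithZero.exp_zero, WithZero.exp_lt_exp]; omega
  have hϖ1 : Valued.v ϖ ≤ 1 := hϖlt.le
  have hϖ10 : ϖ ^ 1 ≠ 0 := pow_ne_zero _ hϖ0
  obtain ⟨hb, x₀, hx₀, hx₀1, hcong⟩ := exists_generator_of_hanging σ hσ hvσ hϖ hH₂ hH₂σ hh hhσ hg hx hx1 hw hcx hwv hnle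
  have hA := axisVertex_eq_latt_endoGL_of_scaleLattice_le σ hσ hvσ hϖ hH₂ hH₂σ hh hhσ hw hb hg hwv
  have hAlev : ∀ a ∈ w ⊓ LinearMap.ker ((LinearMap.proj (1 : Fin 3) : (Fin 3 → K) →ₗ[K] K).restrictScalars 𝒪[K]) ⊔ scaleLattice (ϖ ^ 1) w ⊔ Submodule.span 𝒪[K] {(Pi.single 1 1 : Fin 3 → K)}, (((endoGL (γ₂, u) : GL (Fin 3) K) : Matrix (Fin 3) (Fin 3) K) - 1) *ᵥ a ∈ scaleLattice (ϖ ^ D) (w ⊓ LinearMap.ker ((LinearMap.proj (1 : Fin 3) : (Fin 3 → K) →ₗ[K] K).restrictScalars 𝒪[K]) ⊔ scaleLattice (ϖ ^ 1) w ⊔ Submodule.span 𝒪[K] {(Pi.single 1 1 : Fin 3 → K)}) := by rw [hA]; exact hlev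
  -- integrality of `v`, value congruence
  have hL : IsSelfDualLattice σ ϖ (!![H₂ 0 0, 0, H₂ 0 1; 0, h, 0; H₂ 1 0, 0, H₂ 1 1] : Matrix (Fin 3) (Fin 3) K) (latt ((endoGL (g, (1 : GL (Fin 1) K)) : GL (Fin 3) K) : Matrix (Fin 3) (Fin 3) K)) := (isSelfDualLattice_latt_endoGL_one_iff σ hvσ hϖ0 hϖ1 H₂ hh g).2 hg
  have hLeq := dualLatt_eq_self_of_isSelfDualLattice hvσ (isUnit_det_endoShapeForm hH₂ hh) hL
  have hLd : ∀ a ∈ latt ((endoGL (g, (1 : GL (Fin 1) K)) : GL (Fin 3) K) : Matrix (Fin 3) (Fin 3) K), ∀ b ∈ latt ((endoGL (g, (1 : GL (Fin 1) K)) : GL (Fin 3) K) : Matrix (Fin 3) (Fin 3) K), Valued.v (pairing σ (!![H₂ 0 0, 0, H₂ 0 1; 0, h, 0; H₂ 1 0, 0, H₂ 1 1] : Matrix (Fin 3) (Fin 3) K) a b) ≤ 1 := fun a ha b hb =>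
    (mem_dualLatt σ _ _ b).1 (by rw [hLeq]; exact hb) a ha
  rw [mem_scaleLattice_iff hϖ10] at hcong
  have hxy : ϖ • x₀ = x + ϖ • ((ϖ ^ 1)⁻¹ • (ϖ • x₀ - x)) := by rw [smul_smul, pow_one, mul_inv_cancel₀ hϖ0, one_smul, add_sub_cancel]
  have hΔ := v_inv_pow_mul_pairing_sub_le_of_eq_add_smul σ hvσ hϖ0 hϖ1 hLd (((endoGL (γ₂, u) : GL (Fin 3) K) : Matrix (Fin 3) (Fin 3) K) - 1) hlev hx hcong hxy
  rw [mul_sub] at hΔ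
  have hΔ' := lt_of_le_of_lt hΔ hϖlt
  -- the generator's value is a unit too
  have hunit₀ : Valued.v ((ϖ ^ D)⁻¹ * pairing σ (!![H₂ 0 0, 0, H₂ 0 1; 0, h, 0; H₂ 1 0, 0, H₂ 1 1] : Matrix (Fin 3) (Fin 3) K) (ϖ • x₀) ((((endoGL (γ₂, u) : GL (Fin 3) K) : Matrix (Fin 3) (Fin 3) K) - 1) *ᵥ (ϖ • x₀))) = 1 := by
    have e : (ϖ ^ D)⁻¹ * pairing σ (!![H₂ 0 0, 0, H₂ 0 1; 0, h, 0; H₂ 1 0, 0, H₂ 1 1] : Matrix (Fin 3) (Fin 3) K) (ϖ • x₀) ((((endoGL (γ₂, u) : GL (Fin 3) K) : Matrix (Fin 3) (Fin 3) K) - 1) *ᵥ (ϖ • x₀)) =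
        ((ϖ ^ D)⁻¹ * pairing σ (!![H₂ 0 0, 0, H₂ 0 1; 0, h, 0; H₂ 1 0, 0, H₂ 1 1] : Matrix (Fin 3) (Fin 3) K) (ϖ • x₀) ((((endoGL (γ₂, u) : GL (Fin 3) K) : Matrix (Fin 3) (Fin 3) K) - 1) *ᵥ (ϖ • x₀)) - (ϖ ^ D)⁻¹ * pairing σ (!![H₂ 0 0, 0, H₂ 0 1; 0, h, 0; H₂ 1 0, 0, H₂ 1 1] : Matrix (Fin 3) (Fin 3) K) x ((((endoGL (γ₂, u) : GL (Fin 3) K) : Matrix (Fin 3) (Fin 3) K) - 1) *ᵥ x)) +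
          (ϖ ^ D)⁻¹ * pairing σ (!![H₂ 0 0, 0, H₂ 0 1; 0, h, 0; H₂ 1 0, 0, H₂ 1 1] : Matrix (Fin 3) (Fin 3) K) x ((((endoGL (γ₂, u) : GL (Fin 3) K) : Matrix (Fin 3) (Fin 3) K) - 1) *ᵥ x) := by ring
    rw [e, Valuation.map_add_eq_of_lt_right _ (by rw [hunit]; exact hΔ'), hunit]
  rw [collar_class_iff_of_axisLevel σ hσ hvσ hres hϖ hσϖ hH₂ hH₂σ hh hhσ hw hb hx₀ hx₀1 γ₂ u hD hAlev hunit₀ hc₀]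
  refine exists_congr fun a => and_congr_right fun _ => ?_
  constructor
  · intro h0
    have e : (ϖ ^ D)⁻¹ * pairing σ (!![H₂ 0 0, 0, H₂ 0 1; 0, h, 0; H₂ 1 0, 0, H₂ 1 1] : Matrix (Fin 3) (Fin 3) K) x ((((endoGL (γ₂, u) : GL (Fin 3) K) : Matrix (Fin 3) (Fin 3) K) - 1) *ᵥ x) + c₀ * a ^ 2 =
        ((ϖ ^ D)⁻¹ * pairing σ (!![H₂ 0 0, 0, H₂ 0 1; 0, h, 0; H₂ 1 0, 0, H₂ 1 1] : Matrix (Fin 3) (Fin 3) K) (ϖ • x₀) ((((endoGL (γ₂, u) : GL (Fin 3) K) : Matrix (Fin 3) (Fin 3) K) - 1) *ᵥ (ϖ • x₀)) + c₀ * a ^ 2) -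
          ((ϖ ^ D)⁻¹ * pairing σ (!![H₂ 0 0, 0, H₂ 0 1; 0, h, 0; H₂ 1 0, 0, H₂ 1 1] : Matrix (Fin 3) (Fin 3) K) (ϖ • x₀) ((((endoGL (γ₂, u) : GL (Fin 3) K) : Matrix (Fin 3) (Fin 3) K) - 1) *ᵥ (ϖ • x₀)) - (ϖ ^ D)⁻¹ * pairing σ (!![H₂ 0 0, 0, H₂ 0 1; 0, h, 0; H₂ 1 0, 0, H₂ 1 1] : Matrix (Fin 3) (Fin 3) K) x ((((endoGL (γ₂, u) : GL (Fin 3) K) : Matrix (Fin 3) (Fin 3) K) - 1) *ᵥ x)) := by ring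
    rw [e]; exact lt_of_le_of_lt (Valuation.map_sub _ _ _) (max_lt h0 hΔ')
  · intro h0
    have e : (ϖ ^ D)⁻¹ * pairing σ (!![H₂ 0 0, 0, H₂ 0 1; 0, h, 0; H₂ 1 0, 0, H₂ 1 1] : Matrix (Fin 3) (Fin 3) K) (ϖ • x₀) ((((endoGL (γ₂, u) : GL (Fin 3) K) : Matrix (Fin 3) (Fin 3) K) - 1) *ᵥ (ϖ • x₀)) + c₀ * a ^ 2 =
        ((ϖ ^ D)⁻¹ * pairing σ (!![H₂ 0 0, 0, H₂ 0 1; 0, h, 0; H₂ 1 0, 0, H₂ 1 1] : Matrix (Fin 3) (Fin 3) K) (ϖ • x₀) ((((endoGL (γ₂, u) : GL (Fin 3) K) : Matrix (Fin 3) (Fin 3) K) - 1) *ᵥ (ϖ • x₀)) - (ϖ ^ D)⁻¹ * pairing σ (!![H₂ 0 0, 0, H₂ 0 1; 0, h, 0; H₂ 1 0, 0, H₂ 1 1] : Matrix (Fin 3) (Fin 3) K) x ((((endoGL (γ₂, u) : GL (Fin 3) K) : Matrix (Fin 3) (Fin 3) K) - 1) *ᵥ x)) +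
          ((ϖ ^ D)⁻¹ * pairing σ (!![H₂ 0 0, 0, H₂ 0 1; 0, h, 0; H₂ 1 0, 0, H₂ 1 1] : Matrix (Fin 3) (Fin 3) K) x ((((endoGL (γ₂, u) : GL (Fin 3) K) : Matrix (Fin 3) (Fin 3) K) - 1) *ᵥ x) + c₀ * a ^ 2) := by ring
    rw [e]; exact lt_of_le_of_lt (Valuation.map_add _ _ _) (max_lt hΔ' h0)

/-- **THE CHILD-LINE LAW (top level).**  In the situation of `hanging_fixed_and_lev_iff` with `Γ` UNITARY: if some self-dual `w` below the child `c_x` reaches the full level,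
`LEV[w](ϖ^D)`, then `(Γ − u₀₀·1)·x ∈ ϖ^{D+1}·v` (the child's line is an eigenline of `ϖ^{−D}(γ₂ − 1) mod ϖ` for the eigenvalue `ϖ^{−D}(u₀₀ − 1)`) and `|t(x)| < 1` (★ K4
`collar_levTop_iff_of_axisLevel`).  Contrapositively: below a child whose line is NOT such an eigenline, NONE of the `q` self-dual lattices is a region member.
[cite: Kottwitz1986, §3] [cite: Rogawski1990, §4.9 p. 55] -/
theorem hanging_levTop_imp [IsPrincipalIdealRing 𝒪[K]] (σ : K →+* K) (hσ : ∀ a, σ (σ a) = a) (hvσ : ∀ a, Valued.v (σ a) = Valued.v a)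
    {ϖ : K} (hϖ : Valued.v ϖ = WithZero.exp (-1 : ℤ))
    {H₂ : Matrix (Fin 2) (Fin 2) K} (hH₂ : IsUnit H₂.det) (hH₂σ : (H₂.map σ)ᵀ = H₂) {h : K} (hh : Valued.v h = 1) (hhσ : σ h = h)
    {g : GL (Fin 2) K} (hg : IsSelfDualLattice σ ϖ H₂ (latt (g : Matrix (Fin 2) (Fin 2) K)))
    (γ₂ : GL (Fin 2) K) (u : GL (Fin 1) K) {D : ℕ} (hD : 2 ≤ D)
    (hlev : ∀ a ∈ latt ((endoGL (g, (1 : GL (Fin 1) K)) : GL (Fin 3) K) : Matrix (Fin 3) (Fin 3) K), (((endoGL (γ₂, u) : GL (Fin 3) K) : Matrix (Fin 3) (Fin 3) K) - 1) *ᵥ a ∈ scaleLattice (ϖ ^ D) (latt ((endoGL (g, (1 : GL (Fin 1) K)) : GL (Fin 3) K) : Matrix (Fin 3) (Fin 3) K)))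
    {x : Fin 3 → K} (hx : x ∈ latt ((endoGL (g, (1 : GL (Fin 1) K)) : GL (Fin 3) K) : Matrix (Fin 3) (Fin 3) K)) (hx1 : Valued.v (x 1) = 1)
    {w : Submodule 𝒪[K] (Fin 3 → K)} (hw : IsSelfDualLattice σ ϖ (!![H₂ 0 0, 0, H₂ 0 1; 0, h, 0; H₂ 1 0, 0, H₂ 1 1] : Matrix (Fin 3) (Fin 3) K) w)
    (hcx : ∀ m ∈ latt ((endoGL (g, (1 : GL (Fin 1) K)) : GL (Fin 3) K) : Matrix (Fin 3) (Fin 3) K), Valued.v (pairing σ (!![H₂ 0 0, 0, H₂ 0 1; 0, h, 0; H₂ 1 0, 0, H₂ 1 1] : Matrix (Fin 3) (Fin 3) K) x m) ≤ Valued.v ϖ → m ∈ w)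
    (hwv : scaleLattice (ϖ ^ 1) w ≤ latt ((endoGL (g, (1 : GL (Fin 1) K)) : GL (Fin 3) K) : Matrix (Fin 3) (Fin 3) K)) (hnle : ¬ w ≤ latt ((endoGL (g, (1 : GL (Fin 1) K)) : GL (Fin 3) K) : Matrix (Fin 3) (Fin 3) K))
    (hΓU : endoGL (γ₂, u) ∈ unitaryGroupOfForm σ (!![H₂ 0 0, 0, H₂ 0 1; 0, h, 0; H₂ 1 0, 0, H₂ 1 1] : Matrix (Fin 3) (Fin 3) K))
    (hlevw : ∀ y ∈ w, (((endoGL (γ₂, u) : GL (Fin 3) K) : Matrix (Fin 3) (Fin 3) K) - 1) *ᵥ y ∈ scaleLattice (ϖ ^ D) w) :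
    (((endoGL (γ₂, u) : GL (Fin 3) K) : Matrix (Fin 3) (Fin 3) K) - (u : Matrix (Fin 1) (Fin 1) K) 0 0 • (1 : Matrix (Fin 3) (Fin 3) K)) *ᵥ x ∈ scaleLattice (ϖ ^ (D + 1)) (latt ((endoGL (g, (1 : GL (Fin 1) K)) : GL (Fin 3) K) : Matrix (Fin 3) (Fin 3) K)) ∧
      Valued.v ((ϖ ^ D)⁻¹ * pairing σ (!![H₂ 0 0, 0, H₂ 0 1; 0, h, 0; H₂ 1 0, 0, H₂ 1 1] : Matrix (Fin 3) (Fin 3) K) x ((((endoGL (γ₂, u) : GL (Fin 3) K) : Matrix (Fin 3) (Fin 3) K) - 1) *ᵥ x)) < 1 := by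
  have hϖ0' : Valued.v ϖ ≠ 0 := by rw [hϖ]; exact WithZero.exp_ne_zero
  have hϖ0 : ϖ ≠ 0 := fun h0 => by rw [h0, map_zero] at hϖ0'; exact hϖ0' rfl
  have hϖlt : Valued.v ϖ < 1 := by rw [hϖ, ← WithZero.exp_zero, WithZero.exp_lt_exp]; omega
  have hϖ1 : Valued.v ϖ ≤ 1 := hϖlt.le
  have hϖ10 : ϖ ^ 1 ≠ 0 := pow_ne_zero _ hϖ0
  have hϖD0 : ϖ ^ D ≠ 0 := pow_ne_zero _ hϖ0
  have hϖD0' : Valued.v ϖ ^ D ≠ 0 := pow_ne_zero _ hϖ0'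
  have hϖD10 : ϖ ^ (D + 1) ≠ 0 := pow_ne_zero _ hϖ0
  have hY11 := endoGL_sub_one_apply_one_one γ₂ u
  have hYu := endoGL_sub_one_sub_smul_one γ₂ u
  have hYcol := endoGL_sub_one_col γ₂ u
  obtain ⟨hb, x₀, hx₀, hx₀1, hcong⟩ := exists_generator_of_hanging σ hσ hvσ hϖ hH₂ hH₂σ hh hhσ hg hx hx1 hw hcx hwv hnle
  have hA := axisVertex_eq_latt_endoGL_of_scaleLattice_le σ hσ hvσ hϖ hH₂ hH₂σ hh hhσ hw hb hg hwv
  have hAlev : ∀ a ∈ w ⊓ LinearMap.ker ((LinearMap.proj (1 : Fin 3) : (Fin 3 → K) →ₗ[K] K).restrictScalars 𝒪[K]) ⊔ scaleLattice (ϖ ^ 1) w ⊔ Submodule.span 𝒪[K] {(Pi.single 1 1 : Fin 3 → K)}, (((endoGL (γ₂, u) : GL (Fin 3) K) : Matrix (Fin 3) (Fin 3) K) - 1) *ᵥ a ∈ scaleLattice (ϖ ^ D) (w ⊓ LinearMap.ker ((LinearMap.proj (1 : Fin 3) : (Fin 3 → K) →ₗ[K] K).restrictScalars 𝒪[K]) ⊔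 scaleLattice (ϖ ^ 1) w ⊔ Submodule.span 𝒪[K] {(Pi.single 1 1 : Fin 3 → K)}) := by rw [hA]; exact hlev
  obtain ⟨hgen, hval⟩ := (collar_levTop_iff_of_axisLevel σ hσ hvσ hϖ hH₂ hH₂σ hh hhσ hw hb hx₀ hx₀1 γ₂ u hΓU hD hAlev).1 hlevw
  rw [hA] at hgen
  -- the level of `v` at `e₁`: `|u₀₀ − 1| ≤ |ϖ|^D`
  have hL1 : ∀ m ∈ latt ((endoGL (g, (1 : GL (Fin 1) K)) : GL (Fin 3) K) : Matrix (Fin 3) (Fin 3) K), Valued.v (m 1) ≤ 1 := fun m hm => ((mem_latt_endoGL_one_iff g m).1 hm).2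
  have hsingle : ∀ c : K, (Pi.single 1 c : Fin 3 → K) ∈ latt ((endoGL (g, (1 : GL (Fin 1) K)) : GL (Fin 3) K) : Matrix (Fin 3) (Fin 3) K) ↔ Valued.v c ≤ 1 := fun c => by
    rw [mem_latt_endoGL_one_iff]
    have e : (![(Pi.single 1 c : Fin 3 → K) 0, (Pi.single 1 c : Fin 3 → K) 2] : Fin 2 → K) = 0 := by
      ext i; fin_cases i <;> simp
    rw [e]; simp
  have hδ : Valued.v ((u : Matrix (Fin 1) (Fin 1) K) 0 0 - 1) ≤ Valued.v ϖ ^ D := by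
    have h1 := hlev _ ((hsingle 1).2 (by rw [map_one]))
    rw [mulVec_single_one_of_block hYcol, hY11, mul_one, mem_scaleLattice_iff hϖD0] at h1
    have e : (ϖ ^ D)⁻¹ • (Pi.single 1 ((u : Matrix (Fin 1) (Fin 1) K) 0 0 - 1) : Fin 3 → K) = Pi.single 1 ((ϖ ^ D)⁻¹ * ((u : Matrix (Fin 1) (Fin 1) K) 0 0 - 1)) := by
      ext k; rcases eq_or_ne k 1 with rfl | hk <;> simp [*]
    rw [e] at h1
    have h2 := hL1 _ h1
    rw [Pi.single_eq_same, map_mul, map_inv₀, map_pow, inv_mul_le_iff₀ (zero_lt_iff.2 hϖD0'), mul_one] at h2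
    exact h2
  -- `(Γ − u•1)·m ∈ ϖ^D·v` for `m ∈ v`
  have hSv : ∀ m ∈ latt ((endoGL (g, (1 : GL (Fin 1) K)) : GL (Fin 3) K) : Matrix (Fin 3) (Fin 3) K), (((endoGL (γ₂, u) : GL (Fin 3) K) : Matrix (Fin 3) (Fin 3) K) - (u : Matrix (Fin 1) (Fin 1) K) 0 0 • (1 : Matrix (Fin 3) (Fin 3) K)) *ᵥ m ∈ scaleLattice (ϖ ^ D) (latt ((endoGL (g, (1 : GL (Fin 1) K)) : GL (Fin 3) K) : Matrix (Fin 3) (Fin 3) K)) := fun m hm => by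
    rw [← hYu, sub_smul_one_mulVec, hY11]
    refine Submodule.sub_mem _ (hlev m hm) ?_
    rw [mem_scaleLattice_iff hϖD0, smul_smul]
    exact smul_mem_of_v_le _ (by rw [map_mul, map_inv₀, map_pow, inv_mul_le_iff₀ (zero_lt_iff.2 hϖD0'), mul_one]; exact hδ) hm
  -- `(Γ − u•1)` kills `e₁`-multiples, so `(Γ − u•1)z₀ = (Γ − u•1)(ϖx₀) = (Γ − u•1)x + ϖ(Γ − u•1)y`
  have hScol : ∀ l : Fin 3, l ≠ 1 → (((endoGL (γ₂, u) : GL (Fin 3) K) : Matrix (Fin 3) (Fin 3) K) - (u : Matrix (Fin 1) (Fin 1) K) 0 0 • (1 : Matrix (Fin 3) (Fin 3) K)) l 1 = 0 := fun l hl => by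
    rw [← hYu, Matrix.sub_apply, hYcol l hl, Matrix.smul_apply, Matrix.one_apply_ne hl, smul_zero, sub_zero]
  have hS11 : (((endoGL (γ₂, u) : GL (Fin 3) K) : Matrix (Fin 3) (Fin 3) K) - (u : Matrix (Fin 1) (Fin 1) K) 0 0 • (1 : Matrix (Fin 3) (Fin 3) K)) 1 1 = 0 := by
    rw [← hYu, Matrix.sub_apply, hY11, Matrix.smul_apply, Matrix.one_apply_eq, smul_eq_mul, mul_one, sub_self]
  have hSe : ∀ c : K, (((endoGL (γ₂, u) : GL (Fin 3) K) : Matrix (Fin 3) (Fin 3) K) - (u : Matrix (Fin 1) (Fin 1) K) 0 0 • (1 : Matrix (Fin 3) (Fin 3) K)) *ᵥ (Pi.single 1 c : Fin 3 → K) = 0 := fun c => by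
    rw [mulVec_single_one_of_block hScol, hS11, zero_mul, Pi.single_zero]
  rw [mem_scaleLattice_iff hϖ10] at hcong
  have hz₀ : ((ϖ ^ 1) • (x₀ - Pi.single 1 (x₀ 1)) : Fin 3 → K) = x + ϖ • ((ϖ ^ 1)⁻¹ • (ϖ • x₀ - x)) - Pi.single 1 (ϖ * x₀ 1) := by
    rw [smul_smul, pow_one, mul_inv_cancel₀ hϖ0, one_smul, add_sub_cancel, smul_sub]
    congr 1
    ext k; rcases eq_or_ne k 1 with rfl | hk <;> simp [*]
  rw [hz₀, Matrix.mulVec_sub, hSe, sub_zero, Matrix.mulVec_add, Matrix.mulVec_smul] at hgen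
  refine ⟨?_, ?_⟩
  · -- subtract the `ϖ·ϖ^D`-small term
    have hsmall : ϖ • ((((endoGL (γ₂, u) : GL (Fin 3) K) : Matrix (Fin 3) (Fin 3) K) - (u : Matrix (Fin 1) (Fin 1) K) 0 0 • (1 : Matrix (Fin 3) (Fin 3) K)) *ᵥ ((ϖ ^ 1)⁻¹ • (ϖ • x₀ - x))) ∈ scaleLattice (ϖ ^ (D + 1)) (latt ((endoGL (g, (1 : GL (Fin 1) K)) : GL (Fin 3) K) : Matrix (Fin 3) (Fin 3) K)) := by
      have h1 := hSv _ hcong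
      rw [mem_scaleLattice_iff hϖD0] at h1
      rw [mem_scaleLattice_iff hϖD10, smul_smul, pow_succ, mul_inv_rev, mul_assoc, mul_comm ((ϖ ^ D)⁻¹) ϖ, ← mul_assoc, inv_mul_cancel₀ hϖ0, one_mul]
      exact h1
    have := Submodule.sub_mem _ hgen hsmall
    rwa [add_sub_cancel_right] at this
  · -- `|val₀| ≤ |ϖ|² < 1`, then the value congruence
    have hL : IsSelfDualLattice σ ϖ (!![H₂ 0 0, 0, H₂ 0 1; 0, h, 0; H₂ 1 0, 0, H₂ 1 1] : Matrix (Fin 3) (Fin 3) K) (latt ((endoGL (g, (1 : GL (Fin 1) K)) : GL (Fin 3) K) : Matrix (Fin 3) (Fin 3) K)) := (isSelfDualLattice_latt_endoGL_one_iff σ hvσ hϖ0 hϖ1 H₂ hh g).2 hg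
    have hLeq := dualLatt_eq_self_of_isSelfDualLattice hvσ (isUnit_det_endoShapeForm hH₂ hh) hL
    have hLd : ∀ a ∈ latt ((endoGL (g, (1 : GL (Fin 1) K)) : GL (Fin 3) K) : Matrix (Fin 3) (Fin 3) K), ∀ b ∈ latt ((endoGL (g, (1 : GL (Fin 1) K)) : GL (Fin 3) K) : Matrix (Fin 3) (Fin 3) K), Valued.v (pairing σ (!![H₂ 0 0, 0, H₂ 0 1; 0, h, 0; H₂ 1 0, 0, H₂ 1 1] : Matrix (Fin 3) (Fin 3) K) a b) ≤ 1 := fun a ha b hb =>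
      (mem_dualLatt σ _ _ b).1 (by rw [hLeq]; exact hb) a ha
    have hxy : ϖ • x₀ = x + ϖ • ((ϖ ^ 1)⁻¹ • (ϖ • x₀ - x)) := by rw [smul_smul, pow_one, mul_inv_cancel₀ hϖ0, one_smul, add_sub_cancel]
    have hΔ := v_inv_pow_mul_pairing_sub_le_of_eq_add_smul σ hvσ hϖ0 hϖ1 hLd (((endoGL (γ₂, u) : GL (Fin 3) K) : Matrix (Fin 3) (Fin 3) K) - 1) hlev hx hcong hxy
    rw [mul_sub] at hΔ
    have hΔ' := lt_of_le_of_lt hΔ hϖlt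
    have hval' : Valued.v ((ϖ ^ D)⁻¹ * pairing σ (!![H₂ 0 0, 0, H₂ 0 1; 0, h, 0; H₂ 1 0, 0, H₂ 1 1] : Matrix (Fin 3) (Fin 3) K) (ϖ • x₀) ((((endoGL (γ₂, u) : GL (Fin 3) K) : Matrix (Fin 3) (Fin 3) K) - 1) *ᵥ (ϖ • x₀))) < 1 :=
      lt_of_le_of_lt hval (by rw [pow_two]; exact mul_lt_one_of_nonneg_of_lt_one_left zero_le hϖlt hϖ1)
    have e : (ϖ ^ D)⁻¹ * pairing σ (!![H₂ 0 0, 0, H₂ 0 1; 0, h, 0; H₂ 1 0, 0, H₂ 1 1] : Matrix (Fin 3) (Fin 3) K) x ((((endoGL (γ₂, u) : GL (Fin 3) K) : Matrix (Fin 3) (Fin 3) K) - 1) *ᵥ x) =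
        (ϖ ^ D)⁻¹ * pairing σ (!![H₂ 0 0, 0, H₂ 0 1; 0, h, 0; H₂ 1 0, 0, H₂ 1 1] : Matrix (Fin 3) (Fin 3) K) (ϖ • x₀) ((((endoGL (γ₂, u) : GL (Fin 3) K) : Matrix (Fin 3) (Fin 3) K) - 1) *ᵥ (ϖ • x₀)) -
          ((ϖ ^ D)⁻¹ * pairing σ (!![H₂ 0 0, 0, H₂ 0 1; 0, h, 0; H₂ 1 0, 0, H₂ 1 1] : Matrix (Fin 3) (Fin 3) K) (ϖ • x₀) ((((endoGL (γ₂, u) : GL (Fin 3) K) : Matrix (Fin 3) (Fin 3) K) - 1) *ᵥ (ϖ • x₀)) - (ϖ ^ D)⁻¹ * pairing σ (!![H₂ 0 0, 0, H₂ 0 1; 0, h, 0; H₂ 1 0, 0, H₂ 1 1] : Matrix (Fin 3) (Fin 3) K) x ((((endoGL (γ₂, u) : GL (Fin 3) K) : Matrix (Fin 3) (Fin 3) K) - 1) *ᵥ x)) := by ring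
    rw [e]; exact lt_of_le_of_lt (Valuation.map_sub _ _ _) (max_lt hval' hΔ')


end Literature.NumberTheory.Automorphic.UnitaryLatticeTree

end
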